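import Literature.AlgebraicGeometry.Frobenioids.PadicFrobenioidBaseGaloisSystemCoset
import HarnessLib

/-!
# Transport functors between small coset categories and INNER automorphisms

Mochizuki, *Semi-graphs of anabelioids*, Publ. RIMS **42** (2006), Proposition 3.2 p. 35 (the "Grothendieck
conjecture" for connected temperoids) [cite: MochizukiSemiAnbd2006, Prop 3.2 p.35]: "the category of morphisms
`𝒯₁ → 𝒯₂` is equivalent to the category whose objects are continuous group homomorphisms `φ : Π₁ → Π₂` and whose
morphisms `φ → ψ` are elements `g ∈ Π₂` such that `γ_g ∘ φ = ψ` … In particular, there is a natural bijective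
correspondence between the set of isomorphism classes of morphisms `𝒯₁ → 𝒯₂` and the set of [continuous] outer
homomorphisms `Π₁ → Π₂`"; recalled in [IUTchI] §0 p. 35 and used in the proof of [IUTchI] Cor. 5.3 (ii) p. 144.
Mochizuki, *The geometry of Frobenioids II*, Kyushu J. Math. **62** (2008), Ex. 1.3 (ii) p. 11 (the pull-back
functor along a continuous surjection) [cite: MochizukiFrdII2008, Ex 1.3 (ii) p.11].

PROOF-ONLY companion (theorems only; no definitions, no instances) of abc-iut-L5-t2's `CosetCategories*.lean` (the
SMALL model `CosetCat Π` of `𝓑^temp(Π)⁰`; the transport functor `CosetCat.pull aug : CosetCat G ⥤ CosetCat P` along a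
continuous surjection `aug : P → G`, `G/U ↦ P/aug⁻¹U`) — the dictionary "isomorphism classes of transport functors =
conjugacy classes of maps" (cell abc-iut, L5 hub row «C53ii/N2 COSETCAT-SELFEQUIV-INN», node IUTchI:Cor5.3(ii),
step C53ii/L04 (c); first of two files, the second being `CosetCategoriesEquivalenceInner.lean`):

* `CosetCat.pt_pull_map_coe` — points of `pull.map f`;
* `CosetCat.nonempty_iso_pull_of_forall_conj` — continuous surjections that differ by an INNER automorphism of `P`
  have isomorphic transport functors; `CosetCat.nonempty_pull_id_iso` — transport along `id` is `≅ 𝟭`;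
* `CosetCat.exists_forall_conj_of_pull_iso_pull` — conversely, for `G` TEMPERED (complete and separated,
  [SemiAnbd] Def. 3.1 (i)), isomorphic transport functors differ by an inner automorphism: the components at the
  Galois objects `G/M` are right translations by elements `a_M ∈ P` compatible along the projections, completeness
  glues the `aug(a_M)`, separatedness concludes;
* `CosetCat.nonempty_pull_iso_pull_iff_exists_forall_conj` — for `φ, φ' : G ≃ₜ* P`: `pull φ'⁻¹ ≅ pull φ⁻¹` iff
  `φ' = Inn(x) ∘ φ`.

Pure topological-group / category theory over landed files; nothing of the disputed series is asserted; no side is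
taken on [IUTchIII] Cor. 3.12.
-/

noncomputable section

namespace Literature.AnabelianGeometry.SemiGraphs

open CategoryTheory Opposite _root_.Filter _root_.Topology
open Literature.AlgebraicGeometry.Frobenioids Literature.AlgebraicGeometry.Frobenioids.BaseGaloisSystem

universe u

namespace CosetCat

/-! ### Transport functors `pull` and inner automorphisms -/

section Pull

variable {G : Type u} [Group G] [TopologicalSpace G] {P : Type u} [Group P] [TopologicalSpace P]

/-- Membership in the open subgroup `aug⁻¹(U)` underlying `pull aug (G/U) = P/aug⁻¹(U)`.
[cite: MochizukiFrdII2008, Ex 1.3 (ii) p.11] -/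
theorem mem_pull_obj_sg (aug : P →* G) (hc : Continuous aug) (hs : Function.Surjective aug) (X : CosetCat G)
    (π : P) : π ∈ ((pull aug hc hs).obj X).sg ↔ aug π ∈ X.sg :=
  Iff.rfl

/-- The inverse comparison `G/V ≃ P/aug⁻¹V` sends the coset of `aug π` to the coset of `π`.
[cite: MochizukiFrdII2008, Ex 1.3 (ii) p.11] -/
theorem pullEquiv_symm_coe (aug : P →* G) (hc : Continuous aug) (hs : Function.Surjective aug) (X : CosetCat G)
    (π : P) : (pullEquiv aug hc hs X).symm ((aug π : G) : X.carrier) = (π : ((pull aug hc hs).obj X).carrier) :=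
  (Equiv.symm_apply_eq _).mpr (pullEquiv_coe aug hc hs X π).symm

/-- The point of `pull.map f`: if `pt f = a·V` and `aug π = a` then `pt (pull.map f) = π·aug⁻¹(V)`.
[cite: MochizukiFrdII2008, Ex 1.3 (ii) p.11] -/
theorem pt_pull_map_coe (aug : P →* G) (hc : Continuous aug) (hs : Function.Surjective aug) {X Y : CosetCat G}
    (f : X ⟶ Y) {a : G} (ha : pt f = (a : Y.carrier)) {π : P} (hπ : aug π = a) :
    pt ((pull aug hc hs).map f) = (π : ((pull aug hc hs).obj Y).carrier) := by
  subst hπ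
  rw [pt_pull_map, ha, pullEquiv_symm_coe]

/-- **Inner automorphisms act trivially on transport, up to isomorphism.**  If two continuous surjections
`aug, aug' : P → G` differ by conjugation by `x ∈ P` (`aug'(x π x⁻¹) = aug π`), then the transport functors
`pull aug'`, `pull aug : CosetCat G ⥤ CosetCat P` are isomorphic (component at `G/U`: `π·aug'⁻¹U ↦ π x·aug⁻¹U`).
[cite: MochizukiSemiAnbd2006, Prop 3.2 p.35] -/
theorem nonempty_iso_pull_of_forall_conj (aug aug' : P →* G) (hc : Continuous aug) (hs : Function.Surjective aug)
    (hc' : Continuous aug') (hs' : Function.Surjective aug') (x : P) (hx : ∀ π : P, aug' (x * π * x⁻¹) = aug π) :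
    Nonempty (pull aug' hc' hs' ≅ pull aug hc hs) := by
  -- `aug⁻¹(U) = x⁻¹ · aug'⁻¹(U) · x`
  have hmem : ∀ (X : CosetCat G) (π : P),
      π ∈ ((pull aug hc hs).obj X).sg ↔ x * π * x⁻¹ ∈ ((pull aug' hc' hs').obj X).sg := fun X π => by
    rw [mem_pull_obj_sg, mem_pull_obj_sg, hx]
  -- the components `π·aug'⁻¹U ↦ π x·aug⁻¹U` and their inverses `π·aug⁻¹U ↦ π x⁻¹·aug'⁻¹U`
  have hfix : ∀ X : CosetCat G, ∀ u ∈ ((pull aug' hc' hs').obj X).sg,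
      u • ((x : P) : ((pull aug hc hs).obj X).carrier) = ((x : P) : ((pull aug hc hs).obj X).carrier) := by
    intro X u hu
    rw [MulAction.Quotient.smul_coe, smul_eq_mul, QuotientGroup.eq]
    refine (hmem X _).mpr ?_
    rw [show x * ((u * x)⁻¹ * x) * x⁻¹ = u⁻¹ by group]
    exact inv_mem hu
  have hfix' : ∀ X : CosetCat G, ∀ v ∈ ((pull aug hc hs).obj X).sg,
      v • ((x⁻¹ : P) : ((pull aug' hc' hs').obj X).carrier) = ((x⁻¹ : P) : ((pull aug' hc' hs').obj X).carrier) := by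
    intro X v hv
    rw [MulAction.Quotient.smul_coe, smul_eq_mul, QuotientGroup.eq,
      show (v * x⁻¹)⁻¹ * x⁻¹ = x * v⁻¹ * x⁻¹ by group]
    exact (hmem X _).mp (inv_mem hv)
  -- naturality: both composites `P/aug'⁻¹U → P/aug⁻¹V` send `1` to `π' x = x π (mod aug⁻¹V)`, `aug π = aug' π' = pt f`
  have hnat : ∀ {X Y : CosetCat G} (f : X ⟶ Y),
      (pull aug' hc' hs').map f ≫ homMk _ (hfix Y) = homMk _ (hfix X) ≫ (pull aug hc hs).map f := by
    intro X Y f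
    obtain ⟨a, ha⟩ := QuotientGroup.mk_surjective (pt f)
    obtain ⟨π, hπ⟩ := hs a
    obtain ⟨π', hπ'⟩ := hs' a
    refine hom_ext ?_
    rw [pt_comp, pt_pull_map_coe aug' hc' hs' f ha.symm hπ', homMk_toFun_coe, MulAction.Quotient.smul_coe,
      smul_eq_mul, pt_comp, pt_homMk, toFun_coe, pt_pull_map_coe aug hc hs f ha.symm hπ,
      MulAction.Quotient.smul_coe, smul_eq_mul, QuotientGroup.eq]
    have h1 : aug ((π' * x)⁻¹ * (x * π)) = 1 := by
      rw [show (π' * x)⁻¹ * (x * π) = (x⁻¹ * π'⁻¹ * x) * π by group, map_mul, ← hx,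
        show x * (x⁻¹ * π'⁻¹ * x) * x⁻¹ = π'⁻¹ by group, map_inv, hπ', hπ, inv_mul_cancel]
    exact (show aug ((π' * x)⁻¹ * (x * π)) ∈ Y.sg by rw [h1]; exact one_mem _)
  exact ⟨NatIso.ofComponents (fun X =>
    { hom := homMk _ (hfix X)
      inv := homMk _ (hfix' X)
      hom_inv_id := hom_ext (by
        rw [pt_comp, pt_homMk, homMk_toFun_coe, MulAction.Quotient.smul_coe, smul_eq_mul, mul_inv_cancel,
          pt_id])
      inv_hom_id := hom_ext (by
        rw [pt_comp, pt_homMk, homMk_toFun_coe, MulAction.Quotient.smul_coe, smul_eq_mul, inv_mul_cancel,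
          pt_id]) }) (fun f => hnat f)⟩

/-- **Transport along the identity is the identity functor** (up to isomorphism): `pull id ≅ 𝟭 (CosetCat G)`
(component at `G/U`: `g·id⁻¹(U) ↦ g·U`). [cite: MochizukiFrdII2008, Ex 1.3 (ii) p.11] -/
theorem nonempty_pull_id_iso (hc : Continuous (MonoidHom.id G)) (hs : Function.Surjective (MonoidHom.id G)) :
    Nonempty (pull (MonoidHom.id G) hc hs ≅ 𝟭 (CosetCat G)) := by
  have hfix : ∀ X : CosetCat G, ∀ u ∈ ((pull (MonoidHom.id G) hc hs).obj X).sg,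
      u • ((1 : G) : ((𝟭 (CosetCat G)).obj X).carrier) = ((1 : G) : ((𝟭 (CosetCat G)).obj X).carrier) :=
    fun X u hu => (smul_one_eq_one_iff X u).mpr ((mem_pull_obj_sg (MonoidHom.id G) hc hs X u).mp hu)
  have hfix' : ∀ X : CosetCat G, ∀ u ∈ ((𝟭 (CosetCat G)).obj X).sg,
      u • ((1 : G) : ((pull (MonoidHom.id G) hc hs).obj X).carrier) =
        ((1 : G) : ((pull (MonoidHom.id G) hc hs).obj X).carrier) :=
    fun X u hu => (smul_one_eq_one_iff _ u).mpr ((mem_pull_obj_sg (MonoidHom.id G) hc hs X u).mpr hu)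
  have hnat : ∀ {X Y : CosetCat G} (f : X ⟶ Y),
      (pull (MonoidHom.id G) hc hs).map f ≫ homMk _ (hfix Y) = homMk _ (hfix X) ≫ (𝟭 (CosetCat G)).map f := by
    intro X Y f
    obtain ⟨a, ha⟩ := QuotientGroup.mk_surjective (pt f)
    refine hom_ext ?_
    rw [pt_comp, pt_pull_map_coe (MonoidHom.id G) hc hs f ha.symm (rfl : MonoidHom.id G a = a), homMk_toFun_coe,
      MulAction.Quotient.smul_coe, smul_eq_mul, mul_one, pt_comp, pt_homMk]
    exact ha
  exact ⟨NatIso.ofComponents (fun X =>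
    { hom := homMk _ (hfix X)
      inv := homMk _ (hfix' X)
      hom_inv_id := hom_ext (by rw [pt_comp, pt_homMk, homMk_toFun_coe, one_smul, pt_id])
      inv_hom_id := hom_ext (by rw [pt_comp, pt_homMk, homMk_toFun_coe, one_smul]; rfl) }) (fun f => hnat f)⟩

/-- **Isomorphic transport functors differ by an inner automorphism** (source group tempered).  If
`pull aug' ≅ pull aug : CosetCat G ⥤ CosetCat P` for continuous surjections `aug, aug' : P → G` and `G` is
tempered, then `aug'(x π x⁻¹) = aug π` for some `x ∈ P` and all `π`.  (The components at the Galois objects `G/M`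
are right translations by elements `a_M`, compatible along the projections; completeness of `G` glues the
`aug(a_M)`, separatedness concludes.) [cite: MochizukiSemiAnbd2006, Prop 3.2 p.35] -/
theorem exists_forall_conj_of_pull_iso_pull (hG : IsTempered G) (aug aug' : P →* G) (hc : Continuous aug)
    (hs : Function.Surjective aug) (hc' : Continuous aug') (hs' : Function.Surjective aug')
    (h : Nonempty (pull aug' hc' hs' ≅ pull aug hc hs)) :
    ∃ x : P, ∀ π : P, aug' (x * π * x⁻¹) = aug π := by
  obtain ⟨α⟩ := h
  -- representatives `a M ∈ P` of the points of the components of `α` at the Galois objects `G/M`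
  have hrep : ∀ M : OpenNormalSubgroup G, ∃ aM : P,
      pt (α.hom.app (cQ M)) = (aM : ((pull aug hc hs).obj (cQ M)).carrier) := fun M => by
    obtain ⟨aM, haM⟩ := QuotientGroup.mk_surjective (pt (α.hom.app (cQ M)))
    exact ⟨aM, haM.symm⟩
  choose a ha using hrep
  -- (F1) `aug (a_M⁻¹ π a_M) ≡ aug' π (mod M)`: naturality of `α` at the right translation `r_{aug' π}` of `G/M`
  have hF1 : ∀ (M : OpenNormalSubgroup G) (π : P),
      ((aug ((a M)⁻¹ * π * a M) : G) : G ⧸ M.toSubgroup) = (aug' π : G ⧸ M.toSubgroup) := by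
    intro M π
    obtain ⟨ρ, hρ⟩ := hs (aug' π)
    have hnat := congrArg pt (α.hom.naturality (crightMul M (aug' π)))
    rw [pt_comp, pt_comp, pt_pull_map_coe aug' hc' hs' _ (pt_crightMul M (aug' π)) rfl, toFun_coe, ha M,
      toFun_coe, pt_pull_map_coe aug hc hs _ (pt_crightMul M (aug' π)) hρ, MulAction.Quotient.smul_coe,
      MulAction.Quotient.smul_coe, smul_eq_mul, smul_eq_mul, QuotientGroup.eq] at hnat
    have hmem : aug ((π * a M)⁻¹ * (a M * ρ)) ∈ M := hnat
    have e : (aug ((a M)⁻¹ * π * a M))⁻¹ * aug' π = aug ((π * a M)⁻¹ * (a M * ρ)) := by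
      rw [← hρ, ← map_inv, ← map_mul]
      congr 1
      group
    rw [QuotientGroup.eq, e]
    exact hmem
  -- (F2) compatibility of the `a_M` along the projections `G/M → G/M'`
  have hF2 : ∀ (M M' : OpenNormalSubgroup G), M ≤ M' →
      ((aug (a M') : G) : G ⧸ M'.toSubgroup) = (aug (a M) : G ⧸ M'.toSubgroup) := by
    intro M M' hMM'
    have hnat := congrArg pt (α.hom.naturality (cproj hMM'))
    rw [pt_comp, pt_comp, pt_pull_map_coe aug' hc' hs' _ (pt_cproj hMM') (map_one aug'), toFun_coe, one_smul,
      ha M', ha M, toFun_coe, pt_pull_map_coe aug hc hs _ (pt_cproj hMM') (map_one aug),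
      MulAction.Quotient.smul_coe, smul_eq_mul, mul_one, QuotientGroup.eq] at hnat
    have hmem : aug ((a M')⁻¹ * a M) ∈ M' := hnat
    rw [QuotientGroup.eq, ← map_inv, ← map_mul]
    exact hmem
  -- glue the `aug (a_M)` by completeness of `G`
  obtain ⟨b, hb⟩ := hG.complete (fun M => (aug (a M) : G ⧸ M.toSubgroup)) (by
    intro M M' hMM' g hg
    rw [hF2 M M' hMM']
    rw [QuotientGroup.eq] at hg ⊢
    exact hMM' hg)
  obtain ⟨x, hx⟩ := hs b
  -- `aug (x⁻¹ π x) = aug' π`: congruent modulo every `M`, then separatedness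
  have key : ∀ π : P, aug (x⁻¹ * π * x) = aug' π := by
    intro π
    have hmod : ∀ M : OpenNormalSubgroup G,
        ((aug (x⁻¹ * π * x) : G) : G ⧸ M.toSubgroup) = (aug' π : G ⧸ M.toSubgroup) := by
      intro M
      haveI : M.toSubgroup.Normal := M.isNormal'
      rw [← hF1 M π, map_mul, map_mul, map_inv, hx, map_mul, map_mul, map_inv, QuotientGroup.mk_mul,
        QuotientGroup.mk_mul, QuotientGroup.mk_inv, ← hb M, ← QuotientGroup.mk_inv, ← QuotientGroup.mk_mul,
        ← QuotientGroup.mk_mul]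
    by_contra hne
    obtain ⟨M, hM⟩ := hG.separated ((aug (x⁻¹ * π * x))⁻¹ * aug' π) fun h1 => hne (inv_mul_eq_one.mp h1)
    exact hM (QuotientGroup.eq.mp (hmod M))
  refine ⟨x, fun π => ?_⟩
  rw [← key (x * π * x⁻¹), show x⁻¹ * (x * π * x⁻¹) * x = π by group]

/-- **Isomorphism classes of transport functors ↔ conjugacy classes** (injectivity of the printed bijection, in
transport currency): for `φ, φ' : G ≃ₜ* P` (`G` tempered), `pull φ'⁻¹ ≅ pull φ⁻¹ : CosetCat G ⥤ CosetCat P` iff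
`φ' = Inn(x) ∘ φ` for some `x ∈ P`. [cite: MochizukiSemiAnbd2006, Prop 3.2 p.35] -/
theorem nonempty_pull_iso_pull_iff_exists_forall_conj (hG : IsTempered G) (φ φ' : G ≃ₜ* P)
    (hc : Continuous φ.symm.toMonoidHom) (hs : Function.Surjective φ.symm.toMonoidHom)
    (hc' : Continuous φ'.symm.toMonoidHom) (hs' : Function.Surjective φ'.symm.toMonoidHom) :
    Nonempty (pull φ'.symm.toMonoidHom hc' hs' ≅ pull φ.symm.toMonoidHom hc hs) ↔
      ∃ x : P, ∀ g : G, φ' g = x * φ g * x⁻¹ := by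
  constructor
  · intro h
    obtain ⟨x, hx⟩ := exists_forall_conj_of_pull_iso_pull hG _ _ hc hs hc' hs' h
    refine ⟨x, fun g => ?_⟩
    have h1 : φ'.symm (x * φ g * x⁻¹) = φ.symm (φ g) := hx (φ g)
    rw [ContinuousMulEquiv.symm_apply_apply, ContinuousMulEquiv.symm_apply_eq] at h1
    exact h1.symm
  · rintro ⟨x, hx⟩
    refine nonempty_iso_pull_of_forall_conj _ _ hc hs hc' hs' x fun π => ?_
    change φ'.symm (x * π * x⁻¹) = φ.symm π
    rw [ContinuousMulEquiv.symm_apply_eq, hx, ContinuousMulEquiv.apply_symm_apply]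

end Pull

end CosetCat

end Literature.AnabelianGeometry.SemiGraphs

end
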